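import Summits.ResolutionOfSingularities.KangarooAtlas.MizutaniExtremalProfilePoint
import Summits.ResolutionOfSingularities.KangarooAtlas.MizutaniRationalPointDual
import Summits.ResolutionOfSingularities.KangarooAtlas.MizutaniHironakaSide
import HarnessLib

/-!
# Structure of the EXTREMAL Hironaka schemes at `e = 1` (Mizutani 1973, Thm. 2.8, second part — the `k^{1/p}`-rational point)

Cell `pub-rosobs`, Mizutani enclosure (seat mizutani-encloser-2, gen 6). AI-written; AI review is weaker than expert
review; NOT a resolution-of-singularities theorem (summit relevance C).

Mizutani 1973, Thm. 2.8: «If `H = H(V, W)` is not a vector group, then `dim H ≥ 2p − 1`.  Moreover if `dim H = 2p − 1` and `H`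
is not a vector group with `V ∩ W = {0}`, then `H` is of the same type as Example 2.1.»  The first part is the case `e = 1` of the
cell's `mizutaniLowerBound`.  This file proves the STRUCTURAL CONTENT of the second part that Mizutani obtains before his
Lemma 2.9 (Step (I), p. 91: «the most generic point associated with `H` is a closed point», `codim θ_1(f) = 1`), in the tree's
language.  Let `𝔭` be a point of `ℙ^n_k` with NO linear form through it (`(L_B)_0 = 0`, Mizutani's `V ∩ W = {0}`), with a nonzero
invariant additive form of level one (`(L_B)_1 ≠ 0`: not a vector group) and with `dim B(𝔭) = 2p − 1` read at level one
(`n + 2 = 2p + dim_k (L_B)_1`).  Then: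

* `exists_mem_ne_zero_forall_not_mem_eq_zero` — (linear algebra) a `d`-dimensional subspace of `k^N` has a nonzero vector supported
  in any prescribed set of `≥ N − d + 1` coordinates; `two_mul_add_finrank_invForms_one_le` — the LEVEL-ONE BOUND
  `2p + dim_k (L_B)_1 ≤ n + 2` for every point with `(L_B)_0 = 0 ≠ (L_B)_1`;
* **`exists_eq_ratPoint_of_extremal`** — THE POINT IS `k^{1/p}`-RATIONAL: `𝔭 = ratPoint k p 1 c = [c_0^{1/p} : ⋯ : c_n^{1/p}]` for a
  vector `c` with `k^p`-linearly independent coordinates (every pair of coordinates lies in the support, of size exactly `2p`, of an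
  invariant form, and `MizutaniExtremalProfilePoint.mem_span_xi_pow_of_card_fsupp_eq` makes the `ξ_i^p` proportional);
* **`extremal_of_card_eq`** — in the smallest ambient space `n + 1 = 2p` (Mizutani's Step (I)): `(L_B)_1(𝔭) = k ∙ a` for ONE form
  `a`, whose coefficients are `k^p`-linearly independent, and the DUAL point `𝔭* = ratPoint k p 1 a` has `(L_B)_1(𝔭*) = k ∙ c`
  (BI-DUALITY `H** = H`, Mizutani p. 89, via `mem_invForms_ratPoint_comm`);
* `exists_eq_ratPoint_of_exponent_eq_one` — the same in the vocabulary `exponent k p 𝔭 = 1`, `dim B_{P,𝔭} + 1 = 2p`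
  (`ringKrullDim (S ⧸ bIdeal)`), `hirForms k p 𝔭 0 = ⊥`.

NOT PROVED here (census of the cell): that `n + 1 = 2p` is forced (Mizutani's Step (II), which uses his Lemma 2.9 (1) for
`p ≠ 2` and Hironaka, Ann. of Math. 92 (1970) Th. 3 for `p = 2`), and the normal form of `span_{k^p}{c_i}` («same type as Example 2.1»,
Lemma 2.9 (2), whose proof is only outlined in print).

## References

* H. Mizutani, *Hironaka's additive group schemes*, Nagoya Math. J. 52 (1973) 85–95, Thm. 2.8 and its proof (Steps (I)–(III)),
  Prop. 2.5. [Mizutani1973HironakaGroupSchemes]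
* T. Oda, *Hironaka's additive group scheme, II*, Publ. RIMS 19 (1983), §2, Thm. 3.1. [Oda1983HironakaGroupSchemeII]
-/

noncomputable section

open MvPolynomial TensorProduct Literature.AlgebraicGeometry.Resolution
  Literature.AlgebraicGeometry.Resolution.HironakaScheme

namespace Summit.ResolutionOfSingularities.KangarooAtlas.Mizutani

universe u

/-! ## Linear algebra: nonzero vectors with prescribed support -/

section Support

variable {F : Type*} [Field F] {ι : Type*} [Fintype ι] [DecidableEq ι]

/-- A subspace `P ⊆ F^ι` contains a NONZERO vector supported in `S` as soon as `#ι + 1 ≤ #S + dim P` (the restriction to the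
coordinates outside `S` has a kernel of dimension `≥ dim P − (#ι − #S) ≥ 1`). [folklore] -/
theorem exists_mem_ne_zero_forall_not_mem_eq_zero (P : Submodule F (ι → F)) (S : Finset ι)
    (hS : Fintype.card ι + 1 ≤ S.card + Module.finrank F P) :
    ∃ w ∈ P, w ≠ 0 ∧ ∀ i, i ∉ S → w i = 0 := by
  classical
  set r : P →ₗ[F] ({i // i ∉ S} → F) := (LinearMap.funLeft F F ((↑) : {i // i ∉ S} → ι)).comp P.subtype with hr
  have hrank := LinearMap.finrank_range_add_finrank_ker r
  have hrange : Module.finrank F (LinearMap.range r) ≤ Fintype.card {i // i ∉ S} :=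
    (Submodule.finrank_le _).trans (by rw [Module.finrank_fintype_fun_eq_card])
  have hcompl : Fintype.card {i // i ∉ S} + S.card = Fintype.card ι := by
    rw [Fintype.card_subtype_compl, Fintype.card_coe]
    have := Finset.card_le_univ S
    omega
  have hker : 0 < Module.finrank F (LinearMap.ker r) := by omega
  obtain ⟨x, hx⟩ := (Module.finrank_pos_iff_exists_ne_zero (R := F) (M := LinearMap.ker r)).mp hker
  refine ⟨((x : P) : ι → F), (x : P).2, fun h => hx (Subtype.ext (Subtype.ext h)), fun i hi => ?_⟩
  have h := x.2
  rw [LinearMap.mem_ker] at h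
  exact congrFun h ⟨i, hi⟩

end Support

/-! ## The level-one bound and the `k^{1/p}`-rational point of an extremal scheme -/

section Extremal

variable (k : Type u) [Field k] (p : ℕ) [hp : Fact p.Prime] [CharP k p] {n : ℕ}
  (𝔭 : Ideal (MvPolynomial (Fin (n + 1)) k))

variable {𝔭} in
/-- Converse of `invForms_ratPoint_zero_eq_bot`: if no linear form passes through `[c^{1/p}]`, the `c_i` are `k^p`-linearly independent
(a relation `Σ a_i^p c_i = 0` is the linear form `Σ a_i X_i` through the point). [cite: Mizutani1973HironakaGroupSchemes, Thm. 2.8 ((iv): W minimal)] -/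
theorem linearIndependent_of_invForms_ratPoint_zero_eq_bot {c : Fin (n + 1) → k}
    (h0 : invForms k p (ratPoint k p 1 c) 0 = ⊥) : LinearIndependent (frobPow k p 1) c := by
  classical
  rw [Fintype.linearIndependent_iff]
  intro g hg i
  have hga : ∀ j, ∃ a : k, a ^ p ^ 1 = (g j : k) := fun j => by
    obtain ⟨a, ha⟩ := (g j).2
    exact ⟨a, by rw [← ha]; rfl⟩
  choose a ha using hga
  have hmem : a ∈ invForms k p (ratPoint k p 1 c) 0 := by
    rw [mem_invForms_ratPoint_zero_iff]
    have : ∑ j, a j ^ p ^ 1 * c j = ((∑ j, g j • c j : k)) := Finset.sum_congr rfl fun j _ => by rw [ha j]; rfl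
    rw [this, hg]
  rw [h0, Submodule.mem_bot] at hmem
  have hai : a i = 0 := congrFun hmem i
  apply Subtype.ext
  rw [← ha i, hai, zero_pow (pow_ne_zero _ hp.out.ne_zero)]
  rfl

/-- `Σ_i c_i ⊗ a_i ≠ 0` in `V ⊗_K W` when the `c_i` are `K`-linearly independent and `a ≠ 0` (test against `1 ⊗ λ`, `λ ∈ W^*`). [folklore] -/
theorem sum_tmul_ne_zero_of_linearIndependent {K : Type*} [Field K] {V W : Type*} [AddCommGroup V] [Module K V]
    [AddCommGroup W] [Module K W] {ι : Type*} [Fintype ι] {c : ι → V} (hc : LinearIndependent K c) {a : ι → W}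
    (ha : a ≠ 0) : ∑ i, c i ⊗ₜ[K] a i ≠ 0 := by
  intro h
  apply ha
  funext i
  refine (Module.forall_dual_apply_eq_zero_iff K (a i)).mp fun φ => ?_
  have h1 := congrArg ((TensorProduct.rid K V).toLinearMap ∘ₗ TensorProduct.map LinearMap.id φ) h
  rw [map_zero, map_sum] at h1
  simp only [LinearMap.coe_comp, LinearEquiv.coe_coe, Function.comp_apply, TensorProduct.map_tmul, LinearMap.id_apply,
    TensorProduct.rid_tmul] at h1
  exact Fintype.linearIndependent_iff.mp hc _ h1 i

variable {𝔭} in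
/-- For a point `𝔮 = [a^{1/p}]` and `g ∈ (L_B)_0(𝔮)` (`Σ g_i^p a_i = 0`): `Σ_i g_i^p ⊗ a_i = 0` in `k ⊗_{k^p} k`; hence every
`c ∈ k · F((L_B)_0(𝔮))` has `Σ_i c_i ⊗ a_i = 0`. [folklore] -/
theorem pairTensor_eq_zero_of_mem_span_frobVec {a c : Fin (n + 1) → k}
    (hc : c ∈ Submodule.span k (frobVec k p 1 '' (invForms k p (ratPoint k p 1 a) 0 : Set (Fin (n + 1) → k)))) :
    pairTensor (frobPow k p 1) a c = 0 := by
  have hle : Submodule.span k (frobVec k p 1 '' (invForms k p (ratPoint k p 1 a) 0 : Set (Fin (n + 1) → k))) ≤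
      LinearMap.ker (pairTensor (frobPow k p 1) a) := by
    rw [Submodule.span_le]
    rintro _ ⟨g, hg, rfl⟩
    rw [SetLike.mem_coe, mem_invForms_ratPoint_zero_iff] at hg
    rw [SetLike.mem_coe, LinearMap.mem_ker, pairTensor_apply]
    have hterm : ∀ i, frobVec k p 1 g i ⊗ₜ[frobPow k p 1] a i =
        (1 : k) ⊗ₜ[frobPow k p 1] ((⟨g i ^ p ^ 1, ⟨g i, rfl⟩⟩ : frobPow k p 1) • a i) := by
      intro i
      rw [← TensorProduct.smul_tmul, frobVec]
      congr 1
      rw [Algebra.smul_def, mul_one]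
      rfl
    simp_rw [hterm]
    rw [← TensorProduct.tmul_sum]
    have hsum : ∑ i, ((⟨g i ^ p ^ 1, ⟨g i, rfl⟩⟩ : frobPow k p 1) • a i) = ∑ i, g i ^ p ^ 1 * a i :=
      Finset.sum_congr rfl fun i _ => by rw [Algebra.smul_def]; rfl
    rw [hsum, hg, TensorProduct.tmul_zero]
  exact LinearMap.mem_ker.mp (hle hc)

/-- **The level-one bound** (`m(1) ≥ 2p − 1` read at level one, for points with no linear form): if `(L_B)_0(𝔭) = 0` and
`(L_B)_1(𝔭) ≠ 0`, then `2p + dim_k (L_B)_1 ≤ n + 2`, i.e. `dim B(𝔭)` read at level one is `≥ 2p − 1`.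
[cite: Mizutani1973HironakaGroupSchemes, Thm. 2.8 (first part: dim H ≥ 2p − 1)] -/
theorem two_mul_add_finrank_invForms_one_le (hP : IsPoint k 𝔭) (h0 : invForms k p 𝔭 0 = ⊥)
    (hV : invForms k p 𝔭 1 ≠ ⊥) : 2 * p + Module.finrank k (invForms k p 𝔭 1) ≤ n + 2 := by
  classical
  obtain ⟨f, hfV, hf0⟩ := (Submodule.ne_bot_iff _).mp hV
  -- a nonzero form with small support
  obtain ⟨w, hwV, hwbot, hcard⟩ := exists_small_support' (invForms k p 𝔭 1) ⊥ hfV (by rwa [Submodule.mem_bot])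
  rw [Submodule.mem_bot] at hwbot
  rw [Fintype.card_fin] at hcard
  have h2p := two_mul_le_card_fsupp k p 𝔭 hP h0 hwV hwbot
  have hfin : Module.finrank k (invForms k p 𝔭 1) ≤ n + 1 := finrank_invForms_le k p 𝔭 1
  omega

/-- Nonzero invariant forms of level one supported in any `2p`-set of coordinates (extremal case): for `i₁, i₂` there is
`f ∈ (L_B)_1` with `f_{i₁} ≠ 0`, `f_{i₂} ≠ 0` and `#supp(f) = 2p`. [cite: Mizutani1973HironakaGroupSchemes, proof of Thm. 2.8, Step (II) (Lemma 2.6: the forms f_j = Y_j + Σ c_{ij} X_i)] -/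
theorem exists_mem_invForms_card_fsupp_eq (hP : IsPoint k 𝔭) (h0 : invForms k p 𝔭 0 = ⊥) (hV : invForms k p 𝔭 1 ≠ ⊥)
    (hdim : n + 2 = 2 * p + Module.finrank k (invForms k p 𝔭 1)) (i₁ i₂ : Fin (n + 1)) :
    ∃ f ∈ invForms k p 𝔭 1, f i₁ ≠ 0 ∧ f i₂ ≠ 0 ∧ (fsupp f).card = 2 * p := by
  classical
  -- a set `S ∋ i₁, i₂` of exactly `2p` coordinates
  have h2p : 2 ≤ 2 * p := by have := hp.out.two_le; omega
  have hle : ({i₁, i₂} : Finset (Fin (n + 1))).card ≤ 2 * p := (Finset.card_le_two).trans h2p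
  have hfin : Module.finrank k (invForms k p 𝔭 1) ≤ n + 1 := finrank_invForms_le k p 𝔭 1
  have hVpos : Module.finrank k (invForms k p 𝔭 1) ≠ 0 := fun h => hV (Submodule.finrank_eq_zero.mp h)
  obtain ⟨S, hsub, -, hScard⟩ := Finset.exists_subsuperset_card_eq (Finset.subset_univ ({i₁, i₂} : Finset (Fin (n + 1))))
    hle (by rw [Finset.card_univ, Fintype.card_fin]; omega)
  obtain ⟨f, hfV, hf0, hfS⟩ := exists_mem_ne_zero_forall_not_mem_eq_zero (invForms k p 𝔭 1) S
    (by rw [Fintype.card_fin, hScard]; omega)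
  have hsupp : fsupp f ⊆ S := fun i hi => by
    by_contra hiS
    exact (mem_fsupp.mp hi) (hfS i hiS)
  have hge := two_mul_le_card_fsupp k p 𝔭 hP h0 hfV hf0
  have heq : fsupp f = S := Finset.eq_of_subset_of_card_le hsupp (by omega)
  refine ⟨f, hfV, ?_, ?_, by rw [heq, hScard]⟩
  · exact mem_fsupp.mp (heq ▸ hsub (by simp))
  · exact mem_fsupp.mp (heq ▸ hsub (by simp))

/-- **THE POINT OF AN EXTREMAL SCHEME IS `k^{1/p}`-RATIONAL** (Mizutani's Thm. 2.8, second part, Step (I)/(II) structure): let `𝔭` be a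
point of `ℙ^n_k` with no linear form through it, with `(L_B)_1 ≠ 0` and `dim B(𝔭) + 1 = 2p` read at level one (`n + 2 = 2p + dim (L_B)_1`).
Then `𝔭 = [c_0^{1/p} : ⋯ : c_n^{1/p}]` for a vector `c` (normalised by `c_0 = 1`) whose coordinates are `k^p`-linearly independent.
[cite: Mizutani1973HironakaGroupSchemes, Thm. 2.8 and its proof, Step (I) ("the most generic point associated with H is a closed point")] -/
theorem exists_eq_ratPoint_of_extremal (hP : IsPoint k 𝔭) (h0 : invForms k p 𝔭 0 = ⊥) (hV : invForms k p 𝔭 1 ≠ ⊥)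
    (hdim : n + 2 = 2 * p + Module.finrank k (invForms k p 𝔭 1)) :
    ∃ c : Fin (n + 1) → k, c 0 = 1 ∧ LinearIndependent (frobPow k p 1) c ∧ 𝔭 = ratPoint k p 1 c := by
  classical
  haveI := hP.1
  set i₀ : Fin (n + 1) := 0 with hi₀
  -- every `ξ_i^p` is a multiple of `ξ_{i₀}^p`
  have hprop : ∀ i, ∃ t : k, t • xi k 𝔭 i₀ ^ p = xi k 𝔭 i ^ p := by
    intro i
    obtain ⟨f, hfV, hfi, hfi₀, hcard⟩ := exists_mem_invForms_card_fsupp_eq k p 𝔭 hP h0 hV hdim i i₀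
    exact Submodule.mem_span_singleton.mp (mem_span_xi_pow_of_card_fsupp_eq k p 𝔭 hP h0 hfV hcard hfi hfi₀)
  choose t ht using hprop
  set c : Fin (n + 1) → k := fun i => if i = i₀ then 1 else t i with hc
  have hcξ : ∀ i, c i • xi k 𝔭 i₀ ^ p = xi k 𝔭 i ^ p := by
    intro i
    by_cases hi : i = i₀
    · rw [hc]; simp [hi]
    · rw [hc]; simp [hi, ht i]
  have hc0 : c ≠ 0 := fun h => by
    have := congrFun h i₀
    rw [hc] at this
    simp at this
  -- the relations `c_j ξ_i^p = c_i ξ_j^p`, i.e. `c_j X_i^p − c_i X_j^p ∈ 𝔭`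
  have hrel : ∀ i j, C (c j) * X i ^ p ^ 1 - C (c i) * X j ^ p ^ 1 ∈ 𝔭 := by
    intro i j
    rw [pow_one, ← Ideal.Quotient.eq, map_mul, map_mul, map_pow, map_pow]
    change algebraMap k _ (c j) * xi k 𝔭 i ^ p = algebraMap k _ (c i) * xi k 𝔭 j ^ p
    rw [← Algebra.smul_def, ← Algebra.smul_def, ← hcξ i, ← hcξ j, smul_smul, smul_smul, mul_comm]
  have heq : 𝔭 = ratPoint k p 1 c := eq_ratPoint_of_forall_sub_mem hP hc0 hrel
  exact ⟨c, by rw [hc]; simp, linearIndependent_of_invForms_ratPoint_zero_eq_bot k p (heq ▸ h0), heq⟩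

/-- **The smallest ambient space, `n + 1 = 2p` (Mizutani's Step (I)): ONE invariant form, with independent coefficients, and BI-DUALITY.**
If moreover `n + 1 = 2p` and `a ∈ (L_B)_1(𝔭)` is nonzero, then `(L_B)_1(𝔭) = k ∙ a`, the `2p` coefficients of `a` are `k^p`-linearly
independent, and the dual point `𝔭* = [a^{1/p}]` has `(L_B)_0(𝔭*) = 0` and `(L_B)_1(𝔭*) = k ∙ c` where `𝔭 = [c^{1/p}]` — so `𝔭** = 𝔭`.
[cite: Mizutani1973HironakaGroupSchemes, Thm. 2.8 proof, Step (I) ("2p − 1 ≤ dim H* < 2p, hence dim H* = 2p − 1 and codim θ_1(f) = dim (k·f)* = 1") and Prop. 2.5] -/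
theorem extremal_of_card_eq (hP : IsPoint k 𝔭) (h0 : invForms k p 𝔭 0 = ⊥) (hn : n + 1 = 2 * p)
    {a : Fin (n + 1) → k} (ha : a ∈ invForms k p 𝔭 1) (ha0 : a ≠ 0) :
    ∃ c : Fin (n + 1) → k, LinearIndependent (frobPow k p 1) c ∧ 𝔭 = ratPoint k p 1 c ∧
      invForms k p 𝔭 1 = Submodule.span k {a} ∧ LinearIndependent (frobPow k p 1) a ∧
      invForms k p (ratPoint k p 1 a) 0 = ⊥ ∧ invForms k p (ratPoint k p 1 a) 1 = Submodule.span k {c} := by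
  classical
  have hV : invForms k p 𝔭 1 ≠ ⊥ := fun h => ha0 (by rw [h, Submodule.mem_bot] at ha; exact ha)
  have hbound := two_mul_add_finrank_invForms_one_le k p 𝔭 hP h0 hV
  -- `(L_B)_1 = k ∙ a`
  have hle : Submodule.span k {a} ≤ invForms k p 𝔭 1 := Submodule.span_le.mpr (Set.singleton_subset_iff.mpr ha)
  haveI : FiniteDimensional k (invForms k p 𝔭 1) := FiniteDimensional.finiteDimensional_submodule _
  have hVa : invForms k p 𝔭 1 = Submodule.span k {a} :=
    (Submodule.eq_of_le_of_finrank_le hle (by rw [finrank_span_singleton ha0]; omega)).symm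
  have hdim : n + 2 = 2 * p + Module.finrank k (invForms k p 𝔭 1) := by rw [hVa, finrank_span_singleton ha0]; omega
  obtain ⟨c, -, hcind, heq⟩ := exists_eq_ratPoint_of_extremal k p 𝔭 hP h0 hV hdim
  -- duality: `c ∈ (L_B)_1([a^{1/p}])`
  have ha' : a ∈ invForms k p (ratPoint k p 1 c) 1 := heq ▸ ha
  have hc' : c ∈ invForms k p (ratPoint k p 1 a) 1 := (mem_invForms_ratPoint_comm a c).mp ha'
  have hc0 : c ≠ 0 := fun hz => hcind.ne_zero 0 (congrFun hz 0)
  -- all `a_i ≠ 0` (`#supp(a) ≥ 2p = n + 1`), so no coordinate vanishes at the dual point `𝔮 = [a^{1/p}]`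
  have hsupp := two_mul_le_card_fsupp k p 𝔭 hP h0 ha ha0
  have hai : ∀ i, a i ≠ 0 := by
    intro i
    have hall : fsupp a = Finset.univ := Finset.eq_univ_of_card _ (by
      rw [Fintype.card_fin]; have := Finset.card_le_univ (fsupp a); rw [Fintype.card_fin] at this; omega)
    exact mem_fsupp.mp (hall ▸ Finset.mem_univ i)
  set 𝔮 := ratPoint k p 1 a with h𝔮
  have hQ : IsPoint k 𝔮 := isPoint_ratPoint ha0
  haveI := hQ.1
  have hξ : ∀ i, xi k 𝔮 i ≠ 0 := fun i h => hai i ((X_mem_ratPoint_iff i).mp (Ideal.Quotient.eq_zero_iff_mem.mp h))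
  -- (L_B)_0(𝔮) = 0: otherwise either `c` is NEW at `𝔮` (and a new form of support `≤ 2p − 1` exists) or `Σ c_i ⊗ a_i = 0`
  have hQ0 : invForms k p 𝔮 0 = ⊥ := by
    by_contra hne
    obtain ⟨g, hg, hg0⟩ := (Submodule.ne_bot_iff _).mp hne
    set P' := Submodule.span k (frobVec k p 1 '' (invForms k p 𝔮 0 : Set (Fin (n + 1) → k))) with hP'
    by_cases hcP' : c ∈ P'
    · exact sum_tmul_ne_zero_of_linearIndependent hcind ha0
        ((pairTensor_apply (L := frobPow k p 1) a c).symm.trans (pairTensor_eq_zero_of_mem_span_frobVec k p hcP'))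
    · -- `F g ∈ (L_B)_1(𝔮) ∩ P'`, `F g ≠ 0`, `c ∉ P'`: a new form of small support
      have hFg : frobVec k p 1 g ∈ invForms k p 𝔮 1 := frobVec_one_mem_invForms k p 𝔮 ratPoint_ne_top hg
      have hFgP' : frobVec k p 1 g ∈ P' := Submodule.subset_span ⟨g, hg, rfl⟩
      have hFg0 : frobVec k p 1 g ≠ 0 := by
        intro h
        apply hg0
        funext i
        have := congrFun h i
        rw [frobVec, Pi.zero_apply] at this
        exact eq_zero_of_pow_eq_zero this
      obtain ⟨w, hwP, hwP', hwcard⟩ := exists_small_support' (invForms k p 𝔮 1) P' hc' hcP'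
      rw [Fintype.card_fin] at hwcard
      have hw0 : w ≠ 0 := fun h => hwP' (h ▸ P'.zero_mem)
      obtain ⟨i, hi⟩ : ∃ i, w i ≠ 0 := by
        by_contra hall
        push Not at hall
        exact hw0 (funext hall)
      have hwge := two_mul_le_card_fsupp_of_not_mem_span k p 𝔮 hQ hwP hwP' hi (hξ i)
      -- hence `dim (L_B)_1(𝔮) ≤ 1`, so `(L_B)_1(𝔮) = k ∙ F g ∋ c`: contradiction with `c ∉ P'`
      haveI : FiniteDimensional k (invForms k p 𝔮 1) := FiniteDimensional.finiteDimensional_submodule _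
      have hle1 : Module.finrank k (invForms k p 𝔮 1) ≤ 1 := by omega
      have hspan : Submodule.span k {frobVec k p 1 g} = invForms k p 𝔮 1 :=
        Submodule.eq_of_le_of_finrank_le (Submodule.span_le.mpr (Set.singleton_subset_iff.mpr hFg))
          (by rw [finrank_span_singleton hFg0]; exact hle1)
      apply hcP'
      have hcmem : c ∈ Submodule.span k {frobVec k p 1 g} := hspan ▸ hc'
      have hsub : ({frobVec k p 1 g} : Set (Fin (n + 1) → k)) ⊆
          frobVec k p 1 '' (invForms k p 𝔮 0 : Set (Fin (n + 1) → k)) := Set.singleton_subset_iff.mpr ⟨g, hg, rfl⟩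
      exact Submodule.span_mono hsub hcmem
  have haind : LinearIndependent (frobPow k p 1) a := linearIndependent_of_invForms_ratPoint_zero_eq_bot k p hQ0
  -- `(L_B)_1(𝔮) = k ∙ c` by the level-one bound at `𝔮`
  have hQV : invForms k p 𝔮 1 ≠ ⊥ := fun h => hc0 (by rw [h, Submodule.mem_bot] at hc'; exact hc')
  have hQbound := two_mul_add_finrank_invForms_one_le k p 𝔮 hQ hQ0 hQV
  haveI : FiniteDimensional k (invForms k p 𝔮 1) := FiniteDimensional.finiteDimensional_submodule _
  have hQc : invForms k p 𝔮 1 = Submodule.span k {c} :=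
    (Submodule.eq_of_le_of_finrank_le (Submodule.span_le.mpr (Set.singleton_subset_iff.mpr hc'))
      (by rw [finrank_span_singleton hc0]; omega)).symm
  exact ⟨c, hcind, heq, hVa, haind, hQ0, hQc⟩

/-! ### In the vocabulary `exponent` / `dim B_{P,𝔭}` / `U(𝔭) ∩ L` -/

omit [CharP k p] in
/-- `k · F^m((L_B)) = 0` when `(L_B) = 0`. [folklore] -/
theorem span_frobVec_image_bot (m : ℕ) :
    Submodule.span k (frobVec k p m '' ((⊥ : Submodule k (Fin (n + 1) → k)) : Set (Fin (n + 1) → k))) = ⊥ := by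
  rw [Submodule.bot_coe, Set.image_singleton]
  have : frobVec k p m (0 : Fin (n + 1) → k) = 0 := by
    funext j
    rw [frobVec, Pi.zero_apply, zero_pow (pow_ne_zero _ hp.out.ne_zero)]
  rw [this, Submodule.span_zero_singleton]

/-- Exponent exactly one and no linear form force a nonzero invariant form of level one. [cite: Mizutani1973HironakaGroupSchemes, Rem. 1.2 and §1 (c)] -/
theorem invForms_one_ne_bot_of_exponent_eq_one (hexp : exponent k p 𝔭 = 1) (h0 : invForms k p 𝔭 0 = ⊥) :
    invForms k p 𝔭 1 ≠ ⊥ := by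
  intro h1
  obtain ⟨hE1, hmin⟩ := (exponent_eq_iff k p 𝔭).mp hexp
  refine hmin 0 Nat.zero_lt_one fun j _ => ?_
  rw [h0, span_frobVec_image_bot]
  rcases Nat.eq_zero_or_pos j with rfl | hjpos
  · exact h0
  · rw [hE1 j hjpos, h1, span_frobVec_image_bot]

/-- **Mizutani's Thm. 2.8 (second part), structural content, in Hironaka's/Mizutani's vocabulary**: let `𝔭` be a point of `ℙ^n_k`
such that no linear form has multiplicity one… i.e. `U(𝔭) ∩ L_0 = 0` (no linear form `Σ a_i X_i` lies in `𝔭`: `hirForms k p 𝔭 0 = ⊥`,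
Mizutani's `V ∩ W = {0}`), `B_{P,𝔭}` has exponent exactly `1` (not a vector group, Rem. 1.2) and `dim B_{P,𝔭} = 2p − 1`
(`ringKrullDim (S ⧸ U_+(𝔭)S) + 1 = 2p`).  Then `𝔭 = [c_0^{1/p} : ⋯ : c_n^{1/p}]` is the `k^{1/p}`-rational point of a vector `c` with
`k^p`-linearly independent coordinates («the most generic point associated with `H` is a closed point», proof of Thm. 2.8, Step (I)).
[cite: Mizutani1973HironakaGroupSchemes, Thm. 2.8 (second part) and its proof, Step (I)] -/
theorem exists_eq_ratPoint_of_exponent_eq_one [𝔭.IsPrime] (hP : IsPoint k 𝔭) (hlin : hirForms k p 𝔭 0 = ⊥)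
    (hexp : exponent k p 𝔭 = 1)
    (hdim : ringKrullDim (MvPolynomial (Fin (n + 1)) k ⧸ bIdeal k 𝔭) + 1 = (2 * p : WithBot ℕ∞)) :
    ∃ c : Fin (n + 1) → k, c 0 = 1 ∧ LinearIndependent (frobPow k p 1) c ∧ 𝔭 = ratPoint k p 1 c := by
  have h0 : invForms k p 𝔭 0 = ⊥ := by rw [← hirForms_eq_invForms 𝔭 0]; exact hlin
  have hV := invForms_one_ne_bot_of_exponent_eq_one k p 𝔭 hexp h0
  have hE1 : ExponentLE k p 𝔭 1 := ((exponent_eq_iff k p 𝔭).mp hexp).1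
  rw [ringKrullDim_quotient_bIdeal_eq_hsDim_holds k p 𝔭 hP, ← hsDimAt_eq_hsDim k p 𝔭 hE1] at hdim
  have h1 : hsDimAt k p 𝔭 1 + 1 = 2 * p := by exact_mod_cast hdim
  unfold hsDimAt at h1
  have hfin := finrank_invForms_le k p 𝔭 1
  exact exists_eq_ratPoint_of_extremal k p 𝔭 hP h0 hV (by omega)

end Extremal

end Summit.ResolutionOfSingularities.KangarooAtlas.Mizutani

end
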